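import Summits.ABC.ABC.Theses.IsogenyGlueCongruence
import Summits.ABC.ABC.Theorems.IsogenyGlueCongruenceEllipticGluingPrimeBoundSemistablePointwise
import Summits.ABC.ABC.Theorems.IsogenyGlueCongruenceEllipticGluingPrimeBoundOfSimpleThree
import Summits.ABC.ABC.Theorems.IsogenyGlueCongruenceEllipticGluingPrimeBoundStubCMTorsionCartanImage
import Summits.ABC.ABC.Theorems.IsogenyGlueCongruenceEllipticGluingPrimeBoundFreeOfBound
import Literature.NumberTheory.EllipticCurves.MasserWustholzSurjectivity
import HarnessLib

/-!
# Crux U `EllipticGluingPrimeBound` (stmt-ABC-13919), line `SketchIdeator5` — the semistable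
# restriction from ONE residual: `U_ss ⟸ R_gen,ss` (registered stub `stub_semistableOfGeneric`)

The route consumes the crux U only through its semistable restriction `U_ss` (`stub_semistableGlue`,
…Semistable.lean, p141036).  Here `U_ss` is derived from the generic residual R_gen ALONE, restricted
to semistable curves — without the CM residual R_cm^unif and without `FaltingsTate`, which enter the
landed composition `ellipticGluingPrimeBound_of_simple` only through CM curves:

* `isotypicBound_at_nonCM`, `gluingBound_at` — the `W`-pointwise forms of the non-CM half of
  `isotypicBranchPoly_of_cores` (p94311) and of `bound_of_branches₃` (p118731);
* `stub_semistableOfGeneric` — **Tate–Ogg + MW + R_gen,ss ⟹ U_ss**: at a semistable `W` of conductor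
  `≠ 1` (Tate–Ogg: no curve over `ℚ` has conductor `1` — printed, not in tree; it only empties the
  junk corner `N = 1` of `[NeZero N]`) there is no CM (`not_hasCM_of_isSemistable`), and
  `gluingBound_at` is fed with `stub_irreducibleThreshold`, `stub_dichotomyOfIrreducible` (over
  `stub_geomIsotypicSplitting`, `stub_caseB`), `isotypicBound_at_nonCM` (over `nonCMIsotypicCore_of
  stub_minkowski stub_rationalPartReduction stub_bigImageTorsionCore`) and `freeBound_at` over
  `simpleBound_at_of_generic` (R_gen at `W`) and `stub_quotientByAbelianSubvariety` — all landed,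
  all constants absolute;
* `genericSemistable_of_semistableGluingPrimeBound` (**U_ss ⟹ R_gen,ss**, gluing as p117323) and
  `semistableGluingPrimeBound_iff_genericSemistable`: modulo {Tate–Ogg, MW}, **U_ss ⟺ R_gen,ss** —
  the semistable restriction has a ONE-residual normal form, no CM flank, no `FaltingsTate`.

Conditional results; no definitions; no `sorry`; standard axioms.  Lands `--supports stmt-ABC-13919`.
-/

noncomputable section

-- `Summit.<Summit>.<Problem>` is the mandated summit-side namespace (CONVENTIONS §2); for the
-- single-conjunct summit `ABC` the two coincide, so the duplicate `ABC.ABC` is deliberate.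
set_option linter.dupNamespace false

namespace Summit.ABC.ABC.Theorems.GluingSlices

open CategoryTheory CategoryTheory.Limits AlgebraicGeometry
open Literature.AlgebraicGeometry.Motives
open Summit.ABC.ABC.Theses.IsogenyGlueCongruence
open Summit.ABC.ABC.Theorems.IsotypicMinkowski
open Literature.NumberTheory.EllipticCurves Literature.NumberTheory.DiophantineGeometry

/-! ### The isotypic branch and the gluing bound at a fixed curve -/

/-- **The isotypic branch at a curve whose large primes are surjective** (the non-CM half of
`isotypicBranchPoly_of_cores`, pointwise in `W`; `hMW` is Masser–Wüstholz surjectivity at `W`, which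
holds for non-CM `W`): below the Masser–Wüstholz threshold `ℓ ≤ c · max(1,h)^γ ≤ max c 0 · X^{γ'}`;
beyond it `ρ̄_{W,ℓ}` is surjective and the big-image isotypic core (`hN`, beyond `L₁`) gives
`ℓ ≤ 4 dim B + 1 ≤ 5 X`; `γ' = max 2 γ`, constant `5 + max c 0`, `X = dim B · max(1, h_F W) ≥ 1`. -/
theorem isotypicBound_at_nonCM {W : WeierstrassCurve ℚ} [W.IsElliptic]
    {c γ : ℝ} (hγ : 0 ≤ γ)
    (hMW : ∀ ℓ : ℕ, ℓ.Prime → c * (max 1 W.stableFaltingsHeight) ^ γ < ℓ →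
      W.HasSurjectiveModNGaloisRep ℓ)
    {L₁ : ℕ}
    (hN : ∀ (W : WeierstrassCurve ℚ) [W.IsElliptic] (E B : AbelianVariety.{0} ℚ)
      (e : E.geomPoints ≃+ W.geomPoints),
      (∀ (σ : Field.absoluteGaloisGroup ℚ) (P : E.geomPoints), e (σ • P) = σ • e P) →
      (∀ (C : AbelianVariety.{0} (AlgebraicClosure ℚ))
          (g : B.baseChange (AlgebraicClosure ℚ) ⟶ C),
          Surjective (AbelianVariety.Hom.toSchemeHom g) → C.dim ≠ 0 →
          ∃ f : E.baseChange (AlgebraicClosure ℚ) ⟶ C, f ≠ 0) →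
      ∀ ℓ : ℕ, ℓ.Prime → L₁ < ℓ → W.HasSurjectiveModNGaloisRep ℓ →
      (∃ (α : E ⟶ B) (β : B ⟶ E) (n : ℤ), n ≠ 0 ∧ α ≫ β = n • 𝟙 E) →
      (∀ (α : E ⟶ B) (β : B ⟶ E) (n : ℤ), α ≫ β = n • 𝟙 E → (ℓ : ℤ) ∣ n) →
        ℓ ≤ 4 * B.dim + 1)
    (E B : AbelianVariety.{0} ℚ) (e : E.geomPoints ≃+ W.geomPoints)
    (he : ∀ (σ : Field.absoluteGaloisGroup ℚ) (P : E.geomPoints), e (σ • P) = σ • e P)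
    (hiso : ∀ (C : AbelianVariety.{0} (AlgebraicClosure ℚ))
        (g : B.baseChange (AlgebraicClosure ℚ) ⟶ C),
        Surjective (AbelianVariety.Hom.toSchemeHom g) → C.dim ≠ 0 →
        ∃ f : E.baseChange (AlgebraicClosure ℚ) ⟶ C, f ≠ 0)
    {ℓ : ℕ} (hℓ : ℓ.Prime) (hL₁ : L₁ < ℓ)
    (hex : ∃ (α : E ⟶ B) (β : B ⟶ E) (n : ℤ), n ≠ 0 ∧ α ≫ β = n • 𝟙 E)
    (hall : ∀ (α : E ⟶ B) (β : B ⟶ E) (n : ℤ), α ≫ β = n • 𝟙 E → (ℓ : ℤ) ∣ n) :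
    (ℓ : ℝ) ≤ (5 + max c 0) * ((B.dim : ℝ) * max 1 W.stableFaltingsHeight) ^ (max 2 γ) := by
  set κ' : ℝ := max 2 γ with hκ'
  set X : ℝ := (B.dim : ℝ) * max 1 W.stableFaltingsHeight with hX
  have hdim : (1 : ℝ) ≤ B.dim := Nat.one_le_cast.2 <| Nat.one_le_iff_ne_zero.2
    (EllipticGluingPrimeBound.Negative.dim_ne_zero_of_multiplier e hex)
  have hd0 : (0 : ℝ) ≤ B.dim := zero_le_one.trans hdim
  have hh : (1 : ℝ) ≤ max 1 W.stableFaltingsHeight := le_max_left _ _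
  have hm0 : (0 : ℝ) ≤ max 1 W.stableFaltingsHeight := zero_le_one.trans hh
  have hX1 : 1 ≤ X := by rw [hX]; nlinarith
  have hκ'2 : 2 ≤ κ' := le_max_left _ _
  have hκ'1 : 1 ≤ κ' := by linarith
  have hXpow1 : 1 ≤ X ^ κ' := Real.one_le_rpow hX1 (by linarith)
  have hXpow0 : 0 ≤ X ^ κ' := zero_le_one.trans hXpow1
  have hXle : X ≤ X ^ κ' := by
    simpa only [Real.rpow_one] using Real.rpow_le_rpow_of_exponent_le hX1 hκ'1
  have hdimX : (B.dim : ℝ) ≤ X := by rw [hX]; exact le_mul_of_one_le_right hd0 hh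
  have hmX : max 1 W.stableFaltingsHeight ≤ X := by rw [hX]; exact le_mul_of_one_le_left hm0 hdim
  have hc0 : (0 : ℝ) ≤ max c 0 := le_max_right _ _
  have key : ∀ K : ℝ, K ≤ 5 + max c 0 → (ℓ : ℝ) ≤ K * X ^ κ' →
      (ℓ : ℝ) ≤ (5 + max c 0) * X ^ κ' :=
    fun K hK h ↦ h.trans (mul_le_mul_of_nonneg_right hK hXpow0)
  by_cases hsmall : (ℓ : ℝ) ≤ c * (max 1 W.stableFaltingsHeight) ^ γ
  · refine key (max c 0) (by linarith) ?_
    calc (ℓ : ℝ) ≤ c * (max 1 W.stableFaltingsHeight) ^ γ := hsmall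
      _ ≤ max c 0 * (max 1 W.stableFaltingsHeight) ^ γ :=
          mul_le_mul_of_nonneg_right (le_max_left _ _) (Real.rpow_nonneg hm0 γ)
      _ ≤ max c 0 * X ^ γ := mul_le_mul_of_nonneg_left (Real.rpow_le_rpow hm0 hmX hγ) hc0
      _ ≤ max c 0 * X ^ κ' :=
          mul_le_mul_of_nonneg_left
            (Real.rpow_le_rpow_of_exponent_le hX1 (le_max_right _ _)) hc0
  · have hsurj := hMW ℓ hℓ (lt_of_not_ge hsmall)
    have h1 := hN W E B e he hiso ℓ hℓ hL₁ hsurj hex hall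
    have h1' : (ℓ : ℝ) ≤ 4 * (B.dim : ℝ) + 1 := by exact_mod_cast h1
    refine key 5 (by linarith) ?_
    calc (ℓ : ℝ) ≤ 5 * (B.dim : ℝ) := by linarith
      _ ≤ 5 * X := by linarith
      _ ≤ 5 * X ^ κ' := by linarith

/-- **The crux's bound at a fixed curve from its branches** (`bound_of_branches₃`, pointwise in
`W`): primes `ℓ ≤ max L₀ L₁` are absorbed by the constant; primes below the irreducibility
threshold `c₀ · max(1,h)^γ₀` give `ℓ ≤ max c₀ 0 · X^κ'`; beyond both `W[ℓ]` is irreducible (`hT`),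
the dichotomy `hD` applies, the isotypic case is `hI` at `W` (`dim B₁ ≤ dim B`) and the free case
is `hF` at `W` (`dim A + 1 ≤ dim B`).  `κ' = max 1 (max γ₀ (max γ κ))`,
`C' = max L₀ L₁ + max c₀ 0 + max c 0 + max C 0`, `X = dim B · max(1, h_F W) ≥ 1`. -/
theorem gluingBound_at {W : WeierstrassCurve ℚ} [W.IsElliptic]
    (hD : ∀ (W : WeierstrassCurve ℚ) [W.IsElliptic] (E B : AbelianVariety.{0} ℚ)
      (e : E.geomPoints ≃+ W.geomPoints),
      (∀ (σ : Field.absoluteGaloisGroup ℚ) (P : E.geomPoints), e (σ • P) = σ • e P) →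
      ∀ ℓ : ℕ, ℓ.Prime → W.HasIrreducibleModPGaloisRep ℓ →
      (∃ (α : E ⟶ B) (β : B ⟶ E) (n : ℤ), n ≠ 0 ∧ α ≫ β = n • 𝟙 E) →
      (∀ (α : E ⟶ B) (β : B ⟶ E) (n : ℤ), α ≫ β = n • 𝟙 E → (ℓ : ℤ) ∣ n) →
      (∃ B₁ : AbelianVariety.{0} ℚ, B₁.dim ≤ B.dim ∧
        (∀ (C : AbelianVariety.{0} (AlgebraicClosure ℚ))
            (g : B₁.baseChange (AlgebraicClosure ℚ) ⟶ C),
            Surjective (AbelianVariety.Hom.toSchemeHom g) → C.dim ≠ 0 →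
            ∃ f : E.baseChange (AlgebraicClosure ℚ) ⟶ C, f ≠ 0) ∧
        (∃ (α : E ⟶ B₁) (β : B₁ ⟶ E) (n : ℤ), n ≠ 0 ∧ α ≫ β = n • 𝟙 E) ∧
        (∀ (α : E ⟶ B₁) (β : B₁ ⟶ E) (n : ℤ), α ≫ β = n • 𝟙 E → (ℓ : ℤ) ∣ n)) ∨
      (∃ A : AbelianVariety.{0} ℚ, A.dim + 1 ≤ B.dim ∧
        (∀ f : E.baseChange (AlgebraicClosure ℚ) ⟶ A.baseChange (AlgebraicClosure ℚ), f = 0) ∧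
        ∃ ι : W.geomTorsion ℓ →+ A.geomPoints, Function.Injective ι ∧
          ∀ (σ : Field.absoluteGaloisGroup ℚ) (P : W.geomTorsion ℓ), ι (σ • P) = σ • ι P))
    {L₀ : ℕ} {c₀ γ₀ : ℝ} (hγ₀ : 0 ≤ γ₀)
    (hT : ∀ ℓ : ℕ, ℓ.Prime → L₀ < ℓ → c₀ * (max 1 W.stableFaltingsHeight) ^ γ₀ < ℓ →
      W.HasIrreducibleModPGaloisRep ℓ)
    {L₁ : ℕ} {γ c : ℝ} (hγ : 0 ≤ γ)
    (hI : ∀ (E B : AbelianVariety.{0} ℚ) (e : E.geomPoints ≃+ W.geomPoints),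
      (∀ (σ : Field.absoluteGaloisGroup ℚ) (P : E.geomPoints), e (σ • P) = σ • e P) →
      (∀ (C : AbelianVariety.{0} (AlgebraicClosure ℚ))
          (g : B.baseChange (AlgebraicClosure ℚ) ⟶ C),
          Surjective (AbelianVariety.Hom.toSchemeHom g) → C.dim ≠ 0 →
          ∃ f : E.baseChange (AlgebraicClosure ℚ) ⟶ C, f ≠ 0) →
      ∀ ℓ : ℕ, ℓ.Prime → L₁ < ℓ →
      (∃ (α : E ⟶ B) (β : B ⟶ E) (n : ℤ), n ≠ 0 ∧ α ≫ β = n • 𝟙 E) →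
      (∀ (α : E ⟶ B) (β : B ⟶ E) (n : ℤ), α ≫ β = n • 𝟙 E → (ℓ : ℤ) ∣ n) →
        (ℓ : ℝ) ≤ c * ((B.dim : ℝ) * max 1 W.stableFaltingsHeight) ^ γ)
    {κ C : ℝ} (hκ : 0 ≤ κ)
    (hF : ∀ (E A : AbelianVariety.{0} ℚ) (e : E.geomPoints ≃+ W.geomPoints),
      (∀ (σ : Field.absoluteGaloisGroup ℚ) (P : E.geomPoints), e (σ • P) = σ • e P) →
      (∀ f : E.baseChange (AlgebraicClosure ℚ) ⟶ A.baseChange (AlgebraicClosure ℚ), f = 0) →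
      ∀ ℓ : ℕ, ℓ.Prime → W.HasIrreducibleModPGaloisRep ℓ →
      (∃ ι : W.geomTorsion ℓ →+ A.geomPoints, Function.Injective ι ∧
        ∀ (σ : Field.absoluteGaloisGroup ℚ) (P : W.geomTorsion ℓ), ι (σ • P) = σ • ι P) →
        (ℓ : ℝ) ≤ C * (((A.dim : ℝ) + 1) * max 1 W.stableFaltingsHeight) ^ κ)
    (E B : AbelianVariety.{0} ℚ) (e : E.geomPoints ≃+ W.geomPoints)
    (he : ∀ (σ : Field.absoluteGaloisGroup ℚ) (P : E.geomPoints), e (σ • P) = σ • e P)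
    {ℓ : ℕ} (hℓ : ℓ.Prime)
    (hex : ∃ (α : E ⟶ B) (β : B ⟶ E) (n : ℤ), n ≠ 0 ∧ α ≫ β = n • 𝟙 E)
    (hall : ∀ (α : E ⟶ B) (β : B ⟶ E) (n : ℤ), α ≫ β = n • 𝟙 E → (ℓ : ℤ) ∣ n) :
    (ℓ : ℝ) ≤ (((max L₀ L₁ : ℕ) : ℝ) + max c₀ 0 + max c 0 + max C 0) *
      ((B.dim : ℝ) * max 1 W.stableFaltingsHeight) ^ (max 1 (max γ₀ (max γ κ))) := by
  set κ' : ℝ := max 1 (max γ₀ (max γ κ)) with hκ'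
  set C' : ℝ := ((max L₀ L₁ : ℕ) : ℝ) + max c₀ 0 + max c 0 + max C 0 with hC'
  set X : ℝ := (B.dim : ℝ) * max 1 W.stableFaltingsHeight with hX
  have hdim : (1 : ℝ) ≤ B.dim := by
    exact_mod_cast Nat.one_le_iff_ne_zero.2
      (EllipticGluingPrimeBound.Negative.dim_ne_zero_of_multiplier e hex)
  have hh : (1 : ℝ) ≤ max 1 W.stableFaltingsHeight := le_max_left _ _
  have hm0 : (0 : ℝ) ≤ max 1 W.stableFaltingsHeight := zero_le_one.trans hh
  have hX1 : 1 ≤ X := by rw [hX]; nlinarith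
  have hmX : max 1 W.stableFaltingsHeight ≤ X := by
    rw [hX]
    calc max 1 W.stableFaltingsHeight = 1 * max 1 W.stableFaltingsHeight := (one_mul _).symm
      _ ≤ (B.dim : ℝ) * max 1 W.stableFaltingsHeight := mul_le_mul_of_nonneg_right hdim hm0
  have hκ'1 : 1 ≤ κ' := le_max_left _ _
  have hκ'0 : 0 ≤ κ' := zero_le_one.trans hκ'1
  have hγ₀κ' : γ₀ ≤ κ' := (le_max_left _ _).trans (le_max_right _ _)
  have hγκ' : γ ≤ κ' := ((le_max_left _ _).trans (le_max_right _ _)).trans (le_max_right _ _)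
  have hκκ' : κ ≤ κ' := ((le_max_right _ _).trans (le_max_right _ _)).trans (le_max_right _ _)
  have hXpow1 : 1 ≤ X ^ κ' := Real.one_le_rpow hX1 hκ'0
  have hXpow0 : 0 ≤ X ^ κ' := zero_le_one.trans hXpow1
  have hM0 : (0 : ℝ) ≤ ((max L₀ L₁ : ℕ) : ℝ) := Nat.cast_nonneg _
  have hc₀0 : (0 : ℝ) ≤ max c₀ 0 := le_max_right _ _
  have hc0 : (0 : ℝ) ≤ max c 0 := le_max_right _ _
  have hC0 : (0 : ℝ) ≤ max C 0 := le_max_right _ _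
  have key : ∀ K : ℝ, K ≤ C' → (ℓ : ℝ) ≤ K * X ^ κ' → (ℓ : ℝ) ≤ C' * X ^ κ' :=
    fun K hK h ↦ h.trans (mul_le_mul_of_nonneg_right hK hXpow0)
  by_cases hsmall : ℓ ≤ max L₀ L₁
  · refine key ((max L₀ L₁ : ℕ) : ℝ) (by rw [hC']; linarith) ?_
    calc (ℓ : ℝ) ≤ ((max L₀ L₁ : ℕ) : ℝ) := by exact_mod_cast hsmall
      _ = ((max L₀ L₁ : ℕ) : ℝ) * 1 := (mul_one _).symm
      _ ≤ ((max L₀ L₁ : ℕ) : ℝ) * X ^ κ' := mul_le_mul_of_nonneg_left hXpow1 hM0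
  · push Not at hsmall
    have hL₀ : L₀ < ℓ := lt_of_le_of_lt (le_max_left _ _) hsmall
    have hL₁ : L₁ < ℓ := lt_of_le_of_lt (le_max_right _ _) hsmall
    by_cases hthr : (ℓ : ℝ) ≤ c₀ * (max 1 W.stableFaltingsHeight) ^ γ₀
    · -- below the (height-dependent) irreducibility threshold: the bound holds trivially
      refine key (max c₀ 0) (by rw [hC']; linarith) ?_
      have hY0 : (0 : ℝ) ≤ (max 1 W.stableFaltingsHeight) ^ γ₀ := Real.rpow_nonneg hm0 γ₀
      calc (ℓ : ℝ) ≤ c₀ * (max 1 W.stableFaltingsHeight) ^ γ₀ := hthr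
        _ ≤ max c₀ 0 * (max 1 W.stableFaltingsHeight) ^ γ₀ :=
            mul_le_mul_of_nonneg_right (le_max_left _ _) hY0
        _ ≤ max c₀ 0 * X ^ γ₀ :=
            mul_le_mul_of_nonneg_left (Real.rpow_le_rpow hm0 hmX hγ₀) hc₀0
        _ ≤ max c₀ 0 * X ^ κ' :=
            mul_le_mul_of_nonneg_left (Real.rpow_le_rpow_of_exponent_le hX1 hγ₀κ') hc₀0
    · push Not at hthr
      have hirr : W.HasIrreducibleModPGaloisRep ℓ := hT ℓ hℓ hL₀ hthr
      rcases hD W E B e he ℓ hℓ hirr hex hall with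
        ⟨B₁, hB₁, hiso, hex₁, hall₁⟩ | ⟨A, hA, hfree, hemb⟩
      · refine key (max c 0) (by rw [hC']; linarith) ?_
        have hI1 := hI E B₁ e he hiso ℓ hℓ hL₁ hex₁ hall₁
        have hB₁' : (B₁.dim : ℝ) ≤ B.dim := by exact_mod_cast hB₁
        have hY0 : (0 : ℝ) ≤ (B₁.dim : ℝ) * max 1 W.stableFaltingsHeight :=
          mul_nonneg (Nat.cast_nonneg _) hm0
        have hYX : (B₁.dim : ℝ) * max 1 W.stableFaltingsHeight ≤ X := by
          rw [hX]; exact mul_le_mul_of_nonneg_right hB₁' hm0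
        calc (ℓ : ℝ) ≤ c * ((B₁.dim : ℝ) * max 1 W.stableFaltingsHeight) ^ γ := hI1
          _ ≤ max c 0 * ((B₁.dim : ℝ) * max 1 W.stableFaltingsHeight) ^ γ :=
              mul_le_mul_of_nonneg_right (le_max_left _ _) (Real.rpow_nonneg hY0 γ)
          _ ≤ max c 0 * X ^ γ := mul_le_mul_of_nonneg_left (Real.rpow_le_rpow hY0 hYX hγ) hc0
          _ ≤ max c 0 * X ^ κ' :=
              mul_le_mul_of_nonneg_left (Real.rpow_le_rpow_of_exponent_le hX1 hγκ') hc0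
      · refine key (max C 0) (by rw [hC']; linarith) ?_
        have hF1 := hF E A e he hfree ℓ hℓ hirr hemb
        have hA' : (A.dim : ℝ) + 1 ≤ B.dim := by exact_mod_cast hA
        have hY0 : (0 : ℝ) ≤ ((A.dim : ℝ) + 1) * max 1 W.stableFaltingsHeight :=
          mul_nonneg (by positivity) hm0
        have hYX : ((A.dim : ℝ) + 1) * max 1 W.stableFaltingsHeight ≤ X := by
          rw [hX]; exact mul_le_mul_of_nonneg_right hA' hm0
        calc (ℓ : ℝ) ≤ C * (((A.dim : ℝ) + 1) * max 1 W.stableFaltingsHeight) ^ κ := hF1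
          _ ≤ max C 0 * (((A.dim : ℝ) + 1) * max 1 W.stableFaltingsHeight) ^ κ :=
              mul_le_mul_of_nonneg_right (le_max_left _ _) (Real.rpow_nonneg hY0 κ)
          _ ≤ max C 0 * X ^ κ := mul_le_mul_of_nonneg_left (Real.rpow_le_rpow hY0 hYX hκ) hC0
          _ ≤ max C 0 * X ^ κ' :=
              mul_le_mul_of_nonneg_left (Real.rpow_le_rpow_of_exponent_le hX1 hκκ') hC0

/-! ### The registered stub: `U_ss` from the generic residual alone -/

/-- **Registered stub `stub_semistableOfGeneric` (skeleton v12 of line `SketchIdeator5`):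
Tate–Ogg + Masser–Wüstholz + R_gen,ss ⟹ U_ss.**  For a semistable `W` of conductor `N ≥ 1`:
`N ≠ 1` (Tate–Ogg), so `W` has no CM (`not_hasCM_of_isSemistable`); then `gluingBound_at` at `W`,
fed with the landed irreducibility threshold (`stub_irreducibleThreshold`, MW + the PROVED CM
torsion fact), the landed dichotomy-given-irreducibility (`stub_dichotomyOfIrreducible` over
`stub_geomIsotypicSplitting` and `stub_caseB`), the non-CM isotypic branch at `W`
(`isotypicBound_at_nonCM` over `nonCMIsotypicCore_of stub_minkowski stub_rationalPartReduction
stub_bigImageTorsionCore`) and the free branch at `W` (`freeBound_at` over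
`simpleBound_at_of_generic`, i.e. R_gen at `W`, and `stub_quotientByAbelianSubvariety`).  All
constants are absolute (assembled from those of the hypotheses before `W` is fixed). -/
theorem stub_semistableOfGeneric :
    (∀ (W : WeierstrassCurve ℚ) [W.IsElliptic], W.conductorNorm ℤ ≠ 1) →
    Literature.NumberTheory.EllipticCurves.masserWustholz_surjective_modEll →
    (∃ κ C : ℝ, 0 ≤ κ ∧ ∀ (W : WeierstrassCurve ℚ) [W.IsElliptic] [W.IsGloballyMinimal]
      [NeZero (W.conductorNorm ℤ)], W.IsSemistable ℤ → ∀ (E A : AbelianVariety.{0} ℚ)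
      (e : E.geomPoints ≃+ W.geomPoints),
      (∀ (σ : Field.absoluteGaloisGroup ℚ) (P : E.geomPoints), e (σ • P) = σ • e P) →
      (∀ f : E.baseChange (AlgebraicClosure ℚ) ⟶ A.baseChange (AlgebraicClosure ℚ), f = 0) →
      AbelianVariety.IsSimple A → ¬ W.HasCM →
      ∀ ℓ : ℕ, ℓ.Prime → 5 ≤ ℓ → W.HasSurjectiveModNGaloisRep ℓ →
      (∀ g ∈ commutator (Multiplicative (AddAut (W.geomTorsion ℓ))),
        ∃ σ : Field.absoluteGaloisGroup ℚ,
          (∀ r : A.baseChange (AlgebraicClosure ℚ) ⟶ A.baseChange (AlgebraicClosure ℚ),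
            A.galConj (AlgebraicClosure ℚ) (Field.absoluteGaloisGroup.toAlgEquiv ℚ σ) r = r) ∧
          W.galoisRepTorsion ℓ σ = g) →
      (∃ ι : W.geomTorsion ℓ →+ A.geomPoints, Function.Injective ι ∧
        ∀ (σ : Field.absoluteGaloisGroup ℚ) (P : W.geomTorsion ℓ), ι (σ • P) = σ • ι P) →
        (ℓ : ℝ) ≤ C * (((A.dim : ℝ) + 1) * max 1 W.stableFaltingsHeight) ^ κ) →
    ∃ κ C : ℝ, 0 ≤ κ ∧ ∀ (W : WeierstrassCurve ℚ) [W.IsElliptic] [W.IsGloballyMinimal]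
      [NeZero (W.conductorNorm ℤ)], W.IsSemistable ℤ →
      ∀ (E B : AbelianVariety.{0} ℚ) (e : E.geomPoints ≃+ W.geomPoints),
      (∀ (σ : Field.absoluteGaloisGroup ℚ) (P : E.geomPoints), e (σ • P) = σ • e P) →
      ∀ ℓ : ℕ, ℓ.Prime →
      (∃ (α : E ⟶ B) (β : B ⟶ E) (n : ℤ), n ≠ 0 ∧ α ≫ β = n • 𝟙 E) →
      (∀ (α : E ⟶ B) (β : B ⟶ E) (n : ℤ), α ≫ β = n • 𝟙 E → (ℓ : ℤ) ∣ n) →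
        (ℓ : ℝ) ≤ C * ((B.dim : ℝ) * max 1 W.stableFaltingsHeight) ^ κ := by
  intro hOgg hMWfact hgen
  -- the landed inputs, with their absolute constants
  obtain ⟨L₀, c₀, γ₀, hγ₀, hT⟩ :=
    stub_irreducibleThreshold hMWfact Literature.NumberTheory.EllipticCurves.cmTorsion_cartanImage_holds
  obtain ⟨c, γ, hγ, hMW⟩ := hMWfact
  obtain ⟨κ₁, C₁, -, hG⟩ := hgen
  have hD := stub_dichotomyOfIrreducible stub_geomIsotypicSplitting
    (fun W _ E B B₁ B₂ e he ℓ hℓ hirr hall i j hi hσ α₀ β₀ m hm hndvd ↦ by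
      haveI := hi
      exact stub_caseB e he hℓ hirr hall i j hσ α₀ β₀ m hm hndvd)
  obtain ⟨L₁, hN⟩ := nonCMIsotypicCore_of
    (fun r ℓ hℓ G hG h ↦ by haveI := hG; exact stub_minkowski r ℓ hℓ G h)
    (fun _ _ _ _ e he hiso _ hℓ hirr hsc hex hall ↦
      stub_rationalPartReduction e he hiso hℓ hirr hsc hex hall)
    stub_bigImageTorsionCore
  have hQ := stub_quotientByAbelianSubvariety
  -- the constants
  set κ₂ : ℝ := max 2 (max γ κ₁) with hκ₂def
  set K₂ : ℝ := 5 + max c 0 + max C₁ 0 with hK₂def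
  have hκ₂0 : 0 ≤ κ₂ := zero_le_two.trans (le_max_left _ _)
  have hK₂0 : 0 ≤ K₂ := by
    have h1 : (0 : ℝ) ≤ max c 0 := le_max_right _ _
    have h2 : (0 : ℝ) ≤ max C₁ 0 := le_max_right _ _
    rw [hK₂def]; linarith
  have hγI : (0 : ℝ) ≤ max 2 γ := zero_le_two.trans (le_max_left _ _)
  refine ⟨max 1 (max γ₀ (max (max 2 γ) κ₂)),
    ((max L₀ L₁ : ℕ) : ℝ) + max c₀ 0 + max (5 + max c 0) 0 + max K₂ 0,
    zero_le_one.trans (le_max_left _ _), ?_⟩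
  intro W _ _ _ hss E B e he ℓ hℓ hex hall
  have hcm : ¬ W.HasCM := not_hasCM_of_isSemistable W hss (hOgg W)
  have hMWW : ∀ ℓ : ℕ, ℓ.Prime → c * (max 1 W.stableFaltingsHeight) ^ γ < ℓ →
      W.HasSurjectiveModNGaloisRep ℓ := fun ℓ hℓ h ↦ hMW W hcm ℓ hℓ h
  refine gluingBound_at hD hγ₀ (fun ℓ hℓ hL h ↦ hT W ℓ hℓ hL h) hγI
    (fun E' B' e' he' hiso ℓ' hℓ' hL' hex' hall' ↦
      isotypicBound_at_nonCM hγ hMWW hN E' B' e' he' hiso hℓ' hL' hex' hall')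
    hκ₂0
    (fun E' A e' he' hfree ℓ' hℓ' hirr' hι' ↦ ?_) E B e he hℓ hex hall
  obtain ⟨ι, hι, hιe⟩ := hι'
  refine freeBound_at E' hκ₂0 hK₂0 (fun A' hfree' hsimp ℓ'' hℓ'' _ hι'' ↦ ?_) hQ A.dim hℓ' hirr'
    A hfree ι hι hιe le_rfl
  exact simpleBound_at_of_generic hcm hγ hMWW
    (fun E'' A'' e'' he'' hfree'' hsimp'' hcm'' ℓ₃ hℓ₃ h5 hsurj hfull hι₃ ↦
      hG W hss E'' A'' e'' he'' hfree'' hsimp'' hcm'' ℓ₃ hℓ₃ h5 hsurj hfull hι₃)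
    E' A' e' he' hfree' hsimp hℓ'' hι''

/-! ### Necessity and the one-residual normal form of `U_ss` -/

/-- **U_ss ⟹ R_gen,ss** (glue `E` to the partner along `W[ℓ] ↪ A(ℚ̄)`, `exists_gluing`, and read
`U_ss` at the glued variety of dimension `dim A + 1`), same `κ`, `C`. -/
theorem genericSemistable_of_semistableGluingPrimeBound
    (hU : ∃ κ C : ℝ, 0 ≤ κ ∧ ∀ (W : WeierstrassCurve ℚ) [W.IsElliptic] [W.IsGloballyMinimal]
      [NeZero (W.conductorNorm ℤ)], W.IsSemistable ℤ →
      ∀ (E B : AbelianVariety.{0} ℚ) (e : E.geomPoints ≃+ W.geomPoints),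
      (∀ (σ : Field.absoluteGaloisGroup ℚ) (P : E.geomPoints), e (σ • P) = σ • e P) →
      ∀ ℓ : ℕ, ℓ.Prime →
      (∃ (α : E ⟶ B) (β : B ⟶ E) (n : ℤ), n ≠ 0 ∧ α ≫ β = n • 𝟙 E) →
      (∀ (α : E ⟶ B) (β : B ⟶ E) (n : ℤ), α ≫ β = n • 𝟙 E → (ℓ : ℤ) ∣ n) →
        (ℓ : ℝ) ≤ C * ((B.dim : ℝ) * max 1 W.stableFaltingsHeight) ^ κ) :
    ∃ κ C : ℝ, 0 ≤ κ ∧ ∀ (W : WeierstrassCurve ℚ) [W.IsElliptic] [W.IsGloballyMinimal]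
      [NeZero (W.conductorNorm ℤ)], W.IsSemistable ℤ → ∀ (E A : AbelianVariety.{0} ℚ)
      (e : E.geomPoints ≃+ W.geomPoints),
      (∀ (σ : Field.absoluteGaloisGroup ℚ) (P : E.geomPoints), e (σ • P) = σ • e P) →
      (∀ f : E.baseChange (AlgebraicClosure ℚ) ⟶ A.baseChange (AlgebraicClosure ℚ), f = 0) →
      AbelianVariety.IsSimple A → ¬ W.HasCM →
      ∀ ℓ : ℕ, ℓ.Prime → 5 ≤ ℓ → W.HasSurjectiveModNGaloisRep ℓ →
      (∀ g ∈ commutator (Multiplicative (AddAut (W.geomTorsion ℓ))),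
        ∃ σ : Field.absoluteGaloisGroup ℚ,
          (∀ r : A.baseChange (AlgebraicClosure ℚ) ⟶ A.baseChange (AlgebraicClosure ℚ),
            A.galConj (AlgebraicClosure ℚ) (Field.absoluteGaloisGroup.toAlgEquiv ℚ σ) r = r) ∧
          W.galoisRepTorsion ℓ σ = g) →
      (∃ ι : W.geomTorsion ℓ →+ A.geomPoints, Function.Injective ι ∧
        ∀ (σ : Field.absoluteGaloisGroup ℚ) (P : W.geomTorsion ℓ), ι (σ • P) = σ • ι P) →
        (ℓ : ℝ) ≤ C * (((A.dim : ℝ) + 1) * max 1 W.stableFaltingsHeight) ^ κ := by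
  obtain ⟨κ, C, hκ, hU⟩ := hU
  refine ⟨κ, C, hκ, ?_⟩
  intro W _ _ _ hss E A e he hfree _ _ ℓ hℓ _ _ _ hι
  obtain ⟨ι, hι, hιe⟩ := hι
  obtain ⟨B, hdim, hex, hall⟩ := exists_gluing e he hfree hℓ ι hι hιe
  have hB := hU W hss E B e he ℓ hℓ hex hall
  have hcast : ((B.dim : ℕ) : ℝ) = (A.dim : ℝ) + 1 := by rw [hdim]; push_cast; ring
  rwa [hcast] at hB

/-- **The one-residual normal form**: given Tate–Ogg and the Masser–Wüstholz fact,
**U_ss ⟺ R_gen,ss** — no CM residual and no `FaltingsTate` on either side. -/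
theorem semistableGluingPrimeBound_iff_genericSemistable
    (hOgg : ∀ (W : WeierstrassCurve ℚ) [W.IsElliptic], W.conductorNorm ℤ ≠ 1)
    (hMW : Literature.NumberTheory.EllipticCurves.masserWustholz_surjective_modEll) :
    (∃ κ C : ℝ, 0 ≤ κ ∧ ∀ (W : WeierstrassCurve ℚ) [W.IsElliptic] [W.IsGloballyMinimal]
      [NeZero (W.conductorNorm ℤ)], W.IsSemistable ℤ →
      ∀ (E B : AbelianVariety.{0} ℚ) (e : E.geomPoints ≃+ W.geomPoints),
      (∀ (σ : Field.absoluteGaloisGroup ℚ) (P : E.geomPoints), e (σ • P) = σ • e P) →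
      ∀ ℓ : ℕ, ℓ.Prime →
      (∃ (α : E ⟶ B) (β : B ⟶ E) (n : ℤ), n ≠ 0 ∧ α ≫ β = n • 𝟙 E) →
      (∀ (α : E ⟶ B) (β : B ⟶ E) (n : ℤ), α ≫ β = n • 𝟙 E → (ℓ : ℤ) ∣ n) →
        (ℓ : ℝ) ≤ C * ((B.dim : ℝ) * max 1 W.stableFaltingsHeight) ^ κ) ↔
    (∃ κ C : ℝ, 0 ≤ κ ∧ ∀ (W : WeierstrassCurve ℚ) [W.IsElliptic] [W.IsGloballyMinimal]
      [NeZero (W.conductorNorm ℤ)], W.IsSemistable ℤ → ∀ (E A : AbelianVariety.{0} ℚ)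
      (e : E.geomPoints ≃+ W.geomPoints),
      (∀ (σ : Field.absoluteGaloisGroup ℚ) (P : E.geomPoints), e (σ • P) = σ • e P) →
      (∀ f : E.baseChange (AlgebraicClosure ℚ) ⟶ A.baseChange (AlgebraicClosure ℚ), f = 0) →
      AbelianVariety.IsSimple A → ¬ W.HasCM →
      ∀ ℓ : ℕ, ℓ.Prime → 5 ≤ ℓ → W.HasSurjectiveModNGaloisRep ℓ →
      (∀ g ∈ commutator (Multiplicative (AddAut (W.geomTorsion ℓ))),
        ∃ σ : Field.absoluteGaloisGroup ℚ,
          (∀ r : A.baseChange (AlgebraicClosure ℚ) ⟶ A.baseChange (AlgebraicClosure ℚ),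
            A.galConj (AlgebraicClosure ℚ) (Field.absoluteGaloisGroup.toAlgEquiv ℚ σ) r = r) ∧
          W.galoisRepTorsion ℓ σ = g) →
      (∃ ι : W.geomTorsion ℓ →+ A.geomPoints, Function.Injective ι ∧
        ∀ (σ : Field.absoluteGaloisGroup ℚ) (P : W.geomTorsion ℓ), ι (σ • P) = σ • ι P) →
        (ℓ : ℝ) ≤ C * (((A.dim : ℝ) + 1) * max 1 W.stableFaltingsHeight) ^ κ) :=
  ⟨genericSemistable_of_semistableGluingPrimeBound, stub_semistableOfGeneric hOgg hMW⟩
end Summit.ABC.ABC.Theorems.GluingSlices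

end
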